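import Summits.BirchSwinnertonDyer.BirchSwinnertonDyer.Theorems.GenusKolyvaginAtTwoCasselsTatePairingRat
import Summits.BirchSwinnertonDyer.BirchSwinnertonDyer.Theorems.GenusKolyvaginAtTwoShaCardDvdPowAtTwoRSquareAllowance
import Literature.NumberTheory.EllipticCurves.CasselsTateParity
import Literature.NumberTheory.EllipticCurves.BSDShaProofs
import HarnessLib

/-!
# Consequences of the Cassels–Tate theorem over every number field, now unconditional

Route `GenusKolyvaginAtTwo`, crux `GenusPrimitiveSupplyAtTwo` (stmt-BirchSwinnertonDyer-22136); seat `bsd-line-gk2-p1` g13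
(LEAD, cell `bsd-f1-sign2`), `--supports 22136`, helper. THEOREMS ONLY (no definition, no named fact, no `sorry`).

With `WeierstrassCurve.exists_casselsTate_pairing_holds` (`…Theorems/GenusKolyvaginAtTwoCasselsTatePairingRat.lean`) the
tree's `…_of_casselsTate` lemmas lose their hypothesis `hCT` for every number field `K : Type` and every elliptic `E/K`:

* `exists_nondegenerate_alternating_pairing_sha` — a finite `Ш(E/K)` carries a NON-DEGENERATE alternating pairing into `ℚ/ℤ`;
* `even_padicValNat_shaOrder` — `v_p(#Ш(E/K))` is even for every prime `p` when `Ш(E/K)` is finite;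
* `isSquare_natCard_primaryComponent_sha` — `#Ш(E/K)[p^∞]` is a square when finite (no finiteness of the whole `Ш` needed);
* `exists_natCard_modN_primaryComponent_sha` / `even_finrank_modN_primaryComponent_sha` — `#(Ш(E/K)[p^∞] ⊗ 𝔽_p) = p^{2k}`;
* `natCard_sha_two_dvd_pow_of_dvd_pow_succ` — the one-bit reduction at `p = 2`: `#Ш(E/K)[2^∞] ∣ 2^{2M₀+1} ⟹ ∣ 2^{2M₀}`.

* §3 (append): `forall_primaryComponent_eq_zero_of_orthogonal` (group theory: a pairing with divisible kernel is non-degenerate on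
  a finite `p`-primary component), `exists_addEquiv_prod_self_sha` (**`Ш(E/K) ≃ L × L`** when finite — Cassels' hyperbolic
  structure), `exists_nondegenerate_alternating_pairing_primaryComponent_sha`, `exists_addEquiv_prod_self_primaryComponent_sha`
  (**`Ш(E/K)[p^∞] ≃ L × L`** when finite).
* §4 (append): `isSquare_natCard_sha_torsionBy` (`#Ш(E/K)[n]` square for every `n`, finite `Ш`), `isSquare_natCard_sha_torsionBy_pow`
  (`#Ш(E/K)[p^k]` square for every `k`, finite `Ш[p^∞]`).

BSD is not proved by any of this.

References: [Cassels1962ArithmeticIV] §1; [SilvermanAEC2009] Thm. X.4.14 and Exercise 10.20; [Wall1963QuadraticFormsFiniteGroups] Lemma 7; [MilneADT2006] Ch. I Thm. 6.13,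
Cor. 6.26; [McCallumLMS1991] Thm. 5.4.
-/

noncomputable section

-- `Summit.<P>.<Sub>` repeats `BirchSwinnertonDyer` by the tree's layout convention (D-0017)
set_option linter.dupNamespace false
set_option autoImplicit false

namespace Summit.BirchSwinnertonDyer.BirchSwinnertonDyer.Theorems.GenusExact.CasselsTateNumberField

open _root_.WeierstrassCurve NumberField
open Literature.NumberTheory.EllipticCurves
open Summit.BirchSwinnertonDyer.BirchSwinnertonDyer.Theorems.GenusExact

variable {K : Type} [Field K] [NumberField K] (V : WeierstrassCurve K) [V.IsElliptic] (p : ℕ) [hp : Fact p.Prime]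

omit hp in
/-- **A finite `Ш(E/K)` carries a non-degenerate alternating pairing into `ℚ/ℤ`, unconditionally** (every number field
`K : Type`): the Cassels–Tate pairing (`exists_casselsTate_pairing_holds`; kernel = divisible elements) is non-degenerate because
a finite group has no non-zero divisible element (`divisibleElements_eq_bot_of_finite`). [cite: SilvermanAEC2009, Thm. X.4.14] -/
theorem exists_nondegenerate_alternating_pairing_sha (hfin : V.ShaFinite) :
    ∃ B : V.sha →+ V.sha →+ AddCircle (1 : ℚ), (∀ x, B x x = 0) ∧ ∀ x, (∀ y, B x y = 0) → x = 0 := by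
  haveI : Finite V.sha := hfin
  obtain ⟨B, halt, hker⟩ := exists_casselsTate_pairing_holds (K := K) V
  refine ⟨B, halt, fun x hx0 => ?_⟩
  have hmem : x ∈ AddSubgroup.divisibleElements V.sha := (hker x).mp hx0
  rwa [divisibleElements_eq_bot_of_finite, AddSubgroup.mem_bot] at hmem

/-- **`v_p(#Ш(E/K))` is even when `Ш(E/K)` is finite, unconditionally** (every number field `K : Type`, every prime `p`):
`#Ш` is a square (`isSquare_shaOrder_of_shaFinite`). [cite: SilvermanAEC2009, Thm. X.4.14] -/
theorem even_padicValNat_shaOrder (hfin : V.ShaFinite) : Even (padicValNat p V.shaOrder) := by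
  obtain ⟨r, hr⟩ := isSquare_shaOrder_of_shaFinite V hfin
  have hr0 : r ≠ 0 := fun h0 => (shaOrder_pos V hfin).ne' (by rw [hr, h0, mul_zero])
  rw [hr, padicValNat.mul hr0 hr0]
  exact ⟨_, rfl⟩

/-- **`#Ш(E/K)[p^∞]` is a square when finite, unconditionally** (every number field `K : Type`, every prime `p`; no
finiteness of the whole `Ш` needed): gk2-p3's `VisiblePairAtTwo.isSquare_natCard_primaryComponent_sha_of_casselsTate` with
`hCT` discharged. [cite: SilvermanAEC2009, Thm. X.4.14][cite: Cassels1962ArithmeticIV] -/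
theorem isSquare_natCard_primaryComponent_sha [Finite (AddCommGroup.primaryComponent V.sha p)] :
    IsSquare (Nat.card (AddCommGroup.primaryComponent V.sha p)) :=
  VisiblePairAtTwo.isSquare_natCard_primaryComponent_sha_of_casselsTate V p exists_casselsTate_pairing_holds

/-- **`#(Ш(E/K)[p^∞] ⊗ 𝔽_p) = p^{2k}`, unconditionally** (every number field `K : Type`): the tree's
`exists_natCard_modN_primaryComponent_sha` with `hCT` discharged. [cite: MilneADT2006, Ch. I Cor. 6.26] -/
theorem exists_natCard_modN_primaryComponent_sha :
    ∃ k : ℕ, Nat.card (ModN ↥(AddCommGroup.primaryComponent V.sha p) p) = p ^ (2 * k) :=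
  Literature.NumberTheory.EllipticCurves.exists_natCard_modN_primaryComponent_sha V p exists_casselsTate_pairing_holds

/-- **`dim_{𝔽_p} (Ш(E/K)[p^∞] ⊗ 𝔽_p)` is even, unconditionally** (every number field `K : Type`): the tree's
`even_finrank_modN_primaryComponent_sha` with `hCT` discharged. [cite: MilneADT2006, Ch. I Cor. 6.26] -/
theorem even_finrank_modN_primaryComponent_sha :
    Even (Module.finrank (ZMod p) (ModN ↥(AddCommGroup.primaryComponent V.sha p) p)) :=
  Literature.NumberTheory.EllipticCurves.even_finrank_modN_primaryComponent_sha V p exists_casselsTate_pairing_holds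

omit hp in
/-- **The one-bit reduction at `p = 2`, unconditionally** (every number field `K : Type`): if `#Ш(E/K)[2^∞] ∣ 2^{2M₀+1}` then
`#Ш(E/K)[2^∞] ∣ 2^{2M₀}` — gk2-p3's `VisiblePairAtTwo.natCard_sha_dvd_pow_of_dvd_pow_succ` with `hCT` discharged.
[cite: SilvermanAEC2009, Thm. X.4.14][cite: McCallumLMS1991, Thm. 5.4] -/
theorem natCard_sha_two_dvd_pow_of_dvd_pow_succ {M₀ : ℕ}
    (h : Nat.card (AddCommGroup.primaryComponent V.sha 2) ∣ 2 ^ (2 * M₀ + 1)) :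
    Nat.card (AddCommGroup.primaryComponent V.sha 2) ∣ 2 ^ (2 * M₀) :=
  VisiblePairAtTwo.natCard_sha_dvd_pow_of_dvd_pow_succ exists_casselsTate_pairing_holds V h


/-! ## §3 (append, gk2-p1 g13) The hyperbolic structure `Ш ≃ L × L`; non-degeneracy on a finite `p`-primary part

Group theory first (gk2-p3's argument inside `VisiblePairAtTwo.isSquare_natCard_primaryComponent_sha_of_casselsTate`, isolated as
a lemma): for a torsion abelian group `T` with a bi-additive `B : T × T → ℚ/ℤ` whose left-orthogonal elements are divisible, the
restriction of `B` to a FINITE `p`-primary component is non-degenerate. Then Wall's Lagrangian decomposition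
(`FiniteAbelian.exists_addEquiv_prod_self`) gives `Ш(E/K) ≃ L × L` (finite `Ш`) and `Ш(E/K)[p^∞] ≃ L × L` (finite `Ш[p^∞]`). -/

section Hyperbolic

/-- Two coprime annihilators kill: `a • x = 0`, `b • x = 0`, `a ⊥ b` ⟹ `x = 0`. [folklore] -/
private theorem eq_zero_of_coprime_nsmul_aux {Q : Type*} [AddCommGroup Q] {x : Q} {a b : ℕ} (hab : a.Coprime b)
    (ha : a • x = 0) (hb : b • x = 0) : x = 0 := by
  rw [← addOrderOf_dvd_iff_nsmul_eq_zero] at ha hb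
  exact AddMonoid.addOrderOf_eq_one_iff.mp (Nat.eq_one_of_dvd_coprimes hab ha hb)

/-- **Non-degeneracy on a finite `p`-primary component.** Let `T` be a torsion abelian group and `B : T × T → ℚ/ℤ`
bi-additive such that every left-orthogonal element is divisible (the kernel clause of the Cassels–Tate fact). If the
`p`-primary component `A = T[p^∞]` is finite, then an `a ∈ A` orthogonal to `A` is `0`: it is orthogonal to all of `T`
(coprime orders), hence divisible in `T`, hence `a = p^k • y` with `y ∈ A` and `k = #A`, and `p^k` kills `A`.
[cite: SilvermanAEC2009, Thm. X.4.14 and Exercise 10.20] -/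
theorem forall_primaryComponent_eq_zero_of_orthogonal {T : Type*} [AddCommGroup T] (hT : AddMonoid.IsTorsion T)
    (B : T →+ T →+ AddCircle (1 : ℚ)) (hker : ∀ x, (∀ y, B x y = 0) → x ∈ AddSubgroup.divisibleElements T)
    (q : ℕ) [hq : Fact q.Prime] [Finite (AddCommGroup.primaryComponent T q)] :
    ∀ a : AddCommGroup.primaryComponent T q, (∀ b : AddCommGroup.primaryComponent T q, B a b = 0) → a = 0 := by
  set A : AddSubgroup T := AddCommGroup.primaryComponent T q with hAdef
  have hA : ∀ a : A, ∃ n : ℕ, q ^ n • a = 0 := fun a ↦ by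
    obtain ⟨n, hn⟩ := (AddCommGroup.mem_primaryComponent).mp a.2
    exact ⟨n, Subtype.ext hn⟩
  intro a ha
  obtain ⟨e, he⟩ := hA a
  -- `a` is orthogonal to all of `T`
  have hall : ∀ z : T, B a z = 0 := by
    intro z
    have hz := hT z
    set n := addOrderOf z with hn
    have hn0 : n ≠ 0 := (hz.addOrderOf_pos).ne'
    obtain ⟨v, m, hm, hnm⟩ := Nat.exists_eq_pow_mul_and_not_dvd hn0 q hq.out.ne_one
    have hmz : m • z ∈ A := by
      rw [hAdef, AddCommGroup.mem_primaryComponent]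
      refine ⟨v, ?_⟩
      rw [smul_smul, ← hnm, hn, addOrderOf_nsmul_eq_zero]
    have h1 : m • B a z = 0 := by
      rw [← map_nsmul]
      exact ha ⟨m • z, hmz⟩
    have h2 : q ^ e • B a z = 0 := by
      rw [← AddMonoidHom.nsmul_apply, ← map_nsmul]
      have : (q ^ e • a : A) = 0 := he
      rw [← AddSubgroupClass.coe_nsmul, this, ZeroMemClass.coe_zero, map_zero, AddMonoidHom.zero_apply]
    exact eq_zero_of_coprime_nsmul_aux
      (Nat.Coprime.pow_left e ((Nat.Prime.coprime_iff_not_dvd hq.out).mpr hm)) h2 h1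
  -- hence divisible in `T`: `a = q^k • y` with `y ∈ A`, for `k = #A`
  have hdivz : ((a : A) : T) ∈ AddSubgroup.divisibleElements T := hker _ hall
  set k : ℕ := Nat.card A with hk
  obtain ⟨y, hy⟩ := (AddSubgroup.mem_divisibleElements_iff _ _).mp hdivz (q ^ k) (pow_pos hq.out.pos k)
  have hyA : y ∈ A := by
    rw [hAdef, AddCommGroup.mem_primaryComponent]
    refine ⟨k + e, ?_⟩
    rw [pow_add, mul_comm, ← smul_smul, hy, ← AddSubgroupClass.coe_nsmul]
    have : (q ^ e • a : A) = 0 := he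
    rw [this, ZeroMemClass.coe_zero]
  -- `q^k` kills `y ∈ A`: the order of `y` is a `q`-power `q^j ∣ #A = k`, so `j < k`
  have hy0 : q ^ k • (⟨y, hyA⟩ : A) = 0 := by
    obtain ⟨n, hn⟩ := hA ⟨y, hyA⟩
    have hdvd : addOrderOf (⟨y, hyA⟩ : A) ∣ q ^ n := addOrderOf_dvd_iff_nsmul_eq_zero.mpr hn
    obtain ⟨j, -, hj⟩ := (Nat.dvd_prime_pow hq.out).mp hdvd
    have hjk : q ^ j ∣ k := hj ▸ addOrderOf_dvd_natCard (⟨y, hyA⟩ : A)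
    have hkpos : 0 < k := Nat.card_pos
    have hjlt : j < k := lt_of_lt_of_le (Nat.lt_pow_self hq.out.one_lt) (Nat.le_of_dvd hkpos hjk)
    apply addOrderOf_dvd_iff_nsmul_eq_zero.mp
    rw [hj]
    exact pow_dvd_pow q hjlt.le
  apply Subtype.ext
  rw [ZeroMemClass.coe_zero, ← hy]
  have := congrArg (fun t : A ↦ (t : T)) hy0
  simpa only [AddSubgroupClass.coe_nsmul, ZeroMemClass.coe_zero] using this

omit hp in
/-- **`Ш(E/K) ≃ L × L` when finite — the hyperbolic structure of the Tate–Shafarevich group, unconditionally** (every number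
field `K : Type`): a finite abelian group with a non-degenerate alternating pairing into `ℚ/ℤ` is `L × L` for a Lagrangian `L`
(Wall 1963 Lemma 7, tree `FiniteAbelian.exists_addEquiv_prod_self`), applied to the Cassels–Tate pairing
(`exists_nondegenerate_alternating_pairing_sha`). In particular `#Ш(E/K) = #L²`.
[cite: Cassels1962ArithmeticIV, §1][cite: Wall1963QuadraticFormsFiniteGroups, Lemma 7][cite: SilvermanAEC2009, Thm. X.4.14] -/
theorem exists_addEquiv_prod_self_sha (hfin : V.ShaFinite) :
    ∃ L : AddSubgroup V.sha, (Nonempty (V.sha ≃+ L × L)) := by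
  haveI : Finite V.sha := hfin
  obtain ⟨B, halt, hnd⟩ := exists_nondegenerate_alternating_pairing_sha V hfin
  obtain ⟨L, -, hL⟩ := Literature.GroupTheory.FiniteAbelian.exists_addEquiv_prod_self B halt hnd
  exact ⟨L, hL⟩

/-- **The Cassels–Tate pairing restricted to a finite `Ш(E/K)[p^∞]` is alternating and NON-DEGENERATE, unconditionally**
(every number field `K : Type`; no finiteness of the whole `Ш` needed): `forall_primaryComponent_eq_zero_of_orthogonal` applied
to `exists_casselsTate_pairing_holds` and `isTorsion_sha`. [cite: SilvermanAEC2009, Thm. X.4.14][cite: Cassels1962ArithmeticIV, §1] -/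
theorem exists_nondegenerate_alternating_pairing_primaryComponent_sha [Finite (AddCommGroup.primaryComponent V.sha p)] :
    ∃ B : AddCommGroup.primaryComponent V.sha p →+ AddCommGroup.primaryComponent V.sha p →+ AddCircle (1 : ℚ),
      (∀ x, B x x = 0) ∧ ∀ x, (∀ y, B x y = 0) → x = 0 := by
  obtain ⟨B, halt, hker⟩ := exists_casselsTate_pairing_holds (K := K) V
  set A : AddSubgroup V.sha := AddCommGroup.primaryComponent V.sha p with hAdef
  let BA : A →+ A →+ AddCircle (1 : ℚ) := (AddMonoidHom.compHom' A.subtype).comp (B.comp A.subtype)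
  have hBA : ∀ a b : A, BA a b = B a b := fun _ _ ↦ rfl
  refine ⟨BA, fun x => by rw [hBA, halt], fun x hx => ?_⟩
  refine forall_primaryComponent_eq_zero_of_orthogonal V.isTorsion_sha B (fun z hz => (hker z).mp hz) p x fun b => ?_
  rw [← hBA]
  exact hx b

/-- **`Ш(E/K)[p^∞] ≃ L × L` when finite — the hyperbolic structure of the `p`-primary part, unconditionally** (every number
field `K : Type`, every prime `p`; Wall's Lagrangian decomposition of the restricted Cassels–Tate pairing).
[cite: Cassels1962ArithmeticIV, §1][cite: Wall1963QuadraticFormsFiniteGroups, Lemma 7] -/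
theorem exists_addEquiv_prod_self_primaryComponent_sha [Finite (AddCommGroup.primaryComponent V.sha p)] :
    ∃ L : AddSubgroup (AddCommGroup.primaryComponent V.sha p),
      Nonempty (AddCommGroup.primaryComponent V.sha p ≃+ L × L) := by
  obtain ⟨B, halt, hnd⟩ := exists_nondegenerate_alternating_pairing_primaryComponent_sha V p
  obtain ⟨L, -, hL⟩ := Literature.GroupTheory.FiniteAbelian.exists_addEquiv_prod_self B halt hnd
  exact ⟨L, hL⟩

end Hyperbolic


/-! ## §4 (append, gk2-p1 g13) `#Ш(E/K)[n]` and `#Ш(E/K)[p^k]` are squares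

From `Ш ≃ L × L` (§3): `(L × L)[n] ≃ L[n] × L[n]`, so every torsion layer of a finite `Ш(E/K)` — and every layer `Ш(E/K)[p^k]` of a
finite `Ш(E/K)[p^∞]` — has square order (the tree had `n = 2` for finite `Ш`: `isSquare_card_shaTorsionBy_two_of_casselsTate`). -/

section TorsionSquare

/-- An additive isomorphism identifies the `n`-torsion subgroups (as finite cardinalities). [folklore] -/
private theorem natCard_torsionBy_congr {A B : Type*} [AddCommGroup A] [AddCommGroup B] (e : A ≃+ B) (n : ℕ) :
    Nat.card (AddSubgroup.torsionBy A (n : ℤ)) = Nat.card (AddSubgroup.torsionBy B (n : ℤ)) :=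
  Nat.card_congr
    { toFun := fun x => ⟨e x, AddSubgroup.torsionBy.nsmul_iff.mpr (by
        rw [← map_nsmul, AddSubgroup.torsionBy.nsmul_iff.mp x.2, map_zero])⟩
      invFun := fun y => ⟨e.symm y, AddSubgroup.torsionBy.nsmul_iff.mpr (by
        rw [← map_nsmul, AddSubgroup.torsionBy.nsmul_iff.mp y.2, map_zero])⟩
      left_inv := fun x => Subtype.ext (e.symm_apply_apply x)
      right_inv := fun y => Subtype.ext (e.apply_symm_apply y) }

/-- `(A × B)[n] ≃ A[n] × B[n]`, as cardinalities. [folklore] -/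
private theorem natCard_torsionBy_prod {A B : Type*} [AddCommGroup A] [AddCommGroup B] (n : ℕ) :
    Nat.card (AddSubgroup.torsionBy (A × B) (n : ℤ)) =
      Nat.card (AddSubgroup.torsionBy A (n : ℤ)) * Nat.card (AddSubgroup.torsionBy B (n : ℤ)) := by
  rw [← Nat.card_prod]
  exact Nat.card_congr
    { toFun := fun x =>
        (⟨x.1.1, AddSubgroup.torsionBy.nsmul_iff.mpr (by
            have h := AddSubgroup.torsionBy.nsmul_iff.mp x.2
            rw [Prod.ext_iff] at h
            simpa using h.1)⟩,
          ⟨x.1.2, AddSubgroup.torsionBy.nsmul_iff.mpr (by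
            have h := AddSubgroup.torsionBy.nsmul_iff.mp x.2
            rw [Prod.ext_iff] at h
            simpa using h.2)⟩)
      invFun := fun y => ⟨(y.1.1, y.2.1), AddSubgroup.torsionBy.nsmul_iff.mpr (by
            rw [Prod.ext_iff]
            exact ⟨by simpa using AddSubgroup.torsionBy.nsmul_iff.mp y.1.2,
              by simpa using AddSubgroup.torsionBy.nsmul_iff.mp y.2.2⟩)⟩
      left_inv := fun x => Subtype.ext rfl
      right_inv := fun y => Prod.ext (Subtype.ext rfl) (Subtype.ext rfl) }

omit [V.IsElliptic] hp in
/-- `Ш[p^k] = (Ш[p^∞])[p^k]` as cardinalities: the `p^k`-torsion of `Ш` is the `p^k`-torsion of its `p`-primary part. [folklore] -/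
theorem natCard_sha_torsionBy_pow_eq_primaryComponent (k : ℕ) :
    Nat.card (AddSubgroup.torsionBy V.sha ((p ^ k : ℕ) : ℤ)) =
      Nat.card (AddSubgroup.torsionBy (AddCommGroup.primaryComponent V.sha p) ((p ^ k : ℕ) : ℤ)) :=
  Nat.card_congr
    { toFun := fun x => ⟨⟨x.1, (AddCommGroup.mem_primaryComponent).mpr ⟨k, AddSubgroup.torsionBy.nsmul_iff.mp x.2⟩⟩,
        AddSubgroup.torsionBy.nsmul_iff.mpr (Subtype.ext (by
          rw [AddSubgroupClass.coe_nsmul, ZeroMemClass.coe_zero]; exact AddSubgroup.torsionBy.nsmul_iff.mp x.2))⟩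
      invFun := fun y => ⟨(y.1 : V.sha), AddSubgroup.torsionBy.nsmul_iff.mpr (by
          have h := AddSubgroup.torsionBy.nsmul_iff.mp y.2
          rw [← AddSubgroupClass.coe_nsmul, h, ZeroMemClass.coe_zero])⟩
      left_inv := fun x => by ext; rfl
      right_inv := fun y => by ext; rfl }

omit hp in
/-- **`#Ш(E/K)[n]` is a square for every `n`, when `Ш(E/K)` is finite — unconditionally** (every number field `K : Type`):
from `Ш ≃ L × L` (`exists_addEquiv_prod_self_sha`). Extends the tree's `isSquare_card_shaTorsionBy_two_of_casselsTate` (`n = 2`,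
granted hCT) to all `n`, hCT-free. [cite: Cassels1962ArithmeticIV, §1][cite: Wall1963QuadraticFormsFiniteGroups, Lemma 7] -/
theorem isSquare_natCard_sha_torsionBy (hfin : V.ShaFinite) (n : ℕ) :
    IsSquare (Nat.card (AddSubgroup.torsionBy V.sha (n : ℤ))) := by
  obtain ⟨L, ⟨e⟩⟩ := exists_addEquiv_prod_self_sha V hfin
  rw [natCard_torsionBy_congr e n, natCard_torsionBy_prod]
  exact ⟨_, rfl⟩

/-- **`#(Ш(E/K)[p^∞])[n]` is a square for every `n`, when `Ш(E/K)[p^∞]` is finite — unconditionally.**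
[cite: Cassels1962ArithmeticIV, §1][cite: Wall1963QuadraticFormsFiniteGroups, Lemma 7] -/
theorem isSquare_natCard_primaryComponent_sha_torsionBy [Finite (AddCommGroup.primaryComponent V.sha p)] (n : ℕ) :
    IsSquare (Nat.card (AddSubgroup.torsionBy (AddCommGroup.primaryComponent V.sha p) (n : ℤ))) := by
  obtain ⟨L, ⟨e⟩⟩ := exists_addEquiv_prod_self_primaryComponent_sha V p
  rw [natCard_torsionBy_congr e n, natCard_torsionBy_prod]
  exact ⟨_, rfl⟩

/-- **`#Ш(E/K)[p^k]` is a square for every `k`, as soon as `Ш(E/K)[p^∞]` is finite — unconditionally** (every number field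
`K : Type`, every prime `p`; no finiteness of the whole `Ш`). [cite: Cassels1962ArithmeticIV, §1]
[cite: Wall1963QuadraticFormsFiniteGroups, Lemma 7] -/
theorem isSquare_natCard_sha_torsionBy_pow [Finite (AddCommGroup.primaryComponent V.sha p)] (k : ℕ) :
    IsSquare (Nat.card (AddSubgroup.torsionBy V.sha ((p ^ k : ℕ) : ℤ))) := by
  rw [natCard_sha_torsionBy_pow_eq_primaryComponent V p k]
  exact isSquare_natCard_primaryComponent_sha_torsionBy V p (p ^ k)

end TorsionSquare

end Summit.BirchSwinnertonDyer.BirchSwinnertonDyer.Theorems.GenusExact.CasselsTateNumberField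

end
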